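import Mathlib
import Summits.Ventures.HodgeRepro2.BridgeProjector

/-!
# T6A1Monomials — the multigrading (A0.6) of an exterior power of a spanning family of subspaces

Tier-6 sub-goal A1 (route/T6-A1-t6-p1.md §3, layer L2; mathematics of record: route/TIER4.md §A1 =
route/T4-A1-p7.md v6, (A0.6) and Prop. A2.3(i)). Carrier-free: `M` is a module over a field `L`,
`U σ` (σ in a finite index type `S`) a family of subspaces spanning `M`, and `f` a linear endomorphism
of `M` acting on each `U σ` by a scalar `c σ` (in A1: `M = H¹(B, ℂ)`, `U σ = V_σ` the `F`-eigenspaces,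
`f = [x]^*`, `c σ = σ(x)`). For a multi-index `k : S → ℕ` the piece `piece U n k ⊆ ⋀[L]^n M` is the
span of the wedge monomials with exactly `k σ` factors from `U σ` — the prose's `H^{(k)}`; `f` acts
on it by `∏ σ, c σ ^ k σ` — the prose's `χ_k(x) = ∏_σ σ(x)^{k_σ}`; the pieces span `⋀[L]^n M`; and the
Weil pieces `k = n·e_σ` are the images of `⋀[L]^n (U σ)`. The whole is packaged as p4's
`BridgeProjector.EigenData` (p387197) when the eigenvalues `∏ σ, c σ ^ k σ` are pairwise distinct
(Lemma A2.1 in its pairwise form, p4's `BridgePairwise.exists_pairwise_separation`).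
-/

namespace Summit.Ventures.HodgeRepro2.T6.A1Monomials

open Submodule

variable {L : Type*} [Field L] {M : Type*} [AddCommGroup M] [Module L M]
variable {S : Type*} [Fintype S] [DecidableEq S]

/-- The multiplicity vector of a type assignment `t : Fin n → S`: `typeCount t σ = #{i | t i = σ}`
(the prose's `k_σ = #{j : s j = σ}`). -/
def typeCount {n : ℕ} (t : Fin n → S) (σ : S) : ℕ := (Finset.univ.filter fun i => t i = σ).card

/-- The multigraded piece `H^{(k)} ⊆ ⋀[L]^n M`: the span of the wedge monomials `w 0 ∧ ⋯ ∧ w (n-1)`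
with `w i ∈ U (t i)` and `typeCount t = k`. -/
def piece (U : S → Submodule L M) (n : ℕ) (k : S → ℕ) : Submodule L (⋀[L]^n M) :=
  span L {x | ∃ (w : Fin n → M) (t : Fin n → S), (∀ i, w i ∈ U (t i)) ∧ typeCount t = k ∧
    exteriorPower.ιMulti L n w = x}

omit [Fintype S] in
/-- A multiplicity is at most the number of factors. -/
theorem typeCount_le {n : ℕ} (t : Fin n → S) (σ : S) : typeCount t σ ≤ n := by
  unfold typeCount
  exact (Finset.card_le_univ _).trans_eq (Fintype.card_fin n)

/-- The product of the scalars along a monomial is `∏ σ, c σ ^ k σ`. -/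
theorem prod_comp_eq_prod_pow {n : ℕ} (t : Fin n → S) (c : S → L) :
    ∏ i, c (t i) = ∏ σ, c σ ^ typeCount t σ := by
  rw [← Finset.prod_fiberwise Finset.univ t (fun i => c (t i))]
  refine Finset.prod_congr rfl fun σ _ => ?_
  rw [Finset.prod_congr rfl (fun i hi => by rw [(Finset.mem_filter.1 hi).2]), Finset.prod_const]
  rfl

/-- (A0.6): `f` acts on `H^{(k)}` by the scalar `χ_k = ∏ σ, c σ ^ k σ`. -/
theorem map_apply_of_mem_piece (U : S → Submodule L M) (f : Module.End L M) (c : S → L)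
    (hf : ∀ σ, ∀ v ∈ U σ, f v = c σ • v) (n : ℕ) (k : S → ℕ) {x : ⋀[L]^n M}
    (hx : x ∈ piece U n k) :
    exteriorPower.map n f x = (∏ σ, c σ ^ k σ) • x := by
  induction hx using Submodule.span_induction with
  | mem x hx =>
    obtain ⟨w, t, hw, hk, rfl⟩ := hx
    rw [exteriorPower.map_apply_ιMulti]
    have hfw : (⇑f ∘ w) = fun i => c (t i) • w i := by
      funext i
      exact hf _ _ (hw i)
    rw [hfw, AlternatingMap.map_smul_univ, prod_comp_eq_prod_pow, hk]
  | zero => simp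
  | add x y _ _ hx hy => rw [map_add, hx, hy, smul_add]
  | smul a x _ hx => rw [map_smul, hx, smul_comm]

omit [Fintype S] in
/-- The pieces with multiplicities `≤ n` span `⋀[L]^n M` when the `U σ` span `M`. -/
theorem iSup_piece_eq_top (U : S → Submodule L M) (hU : ⨆ σ, U σ = ⊤) (n : ℕ) :
    ⨆ k : S → Fin (n + 1), piece U n (fun σ => (k σ : ℕ)) = ⊤ := by
  have hs : span L (⋃ σ, (U σ : Set M)) = ⊤ := by
    rw [Submodule.span_iUnion]
    simpa only [Submodule.span_eq] using hU
  rw [eq_top_iff, ← exteriorPower.ιMulti_span_of_span L n M hs, Submodule.span_le]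
  rintro x ⟨w, hw, rfl⟩
  have ht : ∀ i, ∃ σ, w i ∈ U σ := fun i => Set.mem_iUnion.1 (hw ⟨i, rfl⟩)
  choose t ht using ht
  let k : S → Fin (n + 1) := fun σ => ⟨typeCount t σ, Nat.lt_succ_of_le (typeCount_le t σ)⟩
  exact Submodule.mem_iSup_of_mem k (Submodule.subset_span ⟨w, t, ht, rfl, rfl⟩)

omit [Fintype S] in
/-- The Weil piece `k = n·e_σ` is the image of `⋀[L]^n (U σ)` (the prose's `∧^4 V_σ = H^{(4e_σ)}`). -/
theorem piece_single (U : S → Submodule L M) (n : ℕ) (σ : S) :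
    piece U n (Pi.single σ n) = (exteriorPower.map n (U σ).subtype).range := by
  apply le_antisymm
  · rw [piece, Submodule.span_le]
    rintro x ⟨w, t, hw, hk, rfl⟩
    have htσ : ∀ i, t i = σ := by
      have hcard : (Finset.univ.filter fun i => t i = σ).card = (Finset.univ : Finset (Fin n)).card := by
        have := congrFun hk σ
        simp only [typeCount, Pi.single_eq_same] at this
        rw [this, Finset.card_univ, Fintype.card_fin]
      intro i
      have hmem : i ∈ Finset.univ.filter fun i => t i = σ := by
        rw [Finset.eq_univ_of_card _ hcard]
        exact Finset.mem_univ i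
      exact (Finset.mem_filter.1 hmem).2
    refine ⟨exteriorPower.ιMulti L n (fun i => (⟨w i, htσ i ▸ hw i⟩ : U σ)), ?_⟩
    rw [exteriorPower.map_apply_ιMulti]
    rfl
  · rw [LinearMap.range_eq_map, ← exteriorPower.ιMulti_span L n (U σ), Submodule.map_span,
      Submodule.span_le]
    rintro x ⟨y, ⟨w, rfl⟩, rfl⟩
    refine Submodule.subset_span ⟨fun i => (w i : M), fun _ => σ, fun i => (w i).2, ?_, ?_⟩
    · funext τ
      by_cases h : τ = σ
      · subst h
        simp only [typeCount, Pi.single_eq_same]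
        simp
      · simp only [typeCount, Pi.single_eq_of_ne h]
        simp [Ne.symm h]
    · rw [exteriorPower.map_apply_ιMulti]
      rfl

/-- The multigrading packaged as p4's `BridgeProjector.EigenData` for `T := ⋀^n f`, with the pieces
indexed by multi-indices with entries `≤ n` and the eigenvalues `χ_k = ∏ σ, c σ ^ k σ`, provided the
eigenvalues are pairwise distinct (Lemma A2.1, pairwise form). -/
theorem eigenData (U : S → Submodule L M) (hU : ⨆ σ, U σ = ⊤) (f : Module.End L M) (c : S → L)
    (hf : ∀ σ, ∀ v ∈ U σ, f v = c σ • v) (n : ℕ)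
    (hinj : Function.Injective fun k : S → Fin (n + 1) => ∏ σ, c σ ^ (k σ : ℕ)) :
    BridgeProjector.EigenData (exteriorPower.map n f)
      (fun k : S → Fin (n + 1) => piece U n fun σ => (k σ : ℕ))
      (fun k => ∏ σ, c σ ^ (k σ : ℕ)) :=
  ⟨iSup_piece_eq_top U hU n, fun _ _ hx => map_apply_of_mem_piece U f c hf n _ hx, hinj⟩

end Summit.Ventures.HodgeRepro2.T6.A1Monomials
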